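import Mathlib
import Summits.NavierStokesRegularity.NavierStokesRegularity.Theorems.DssFarFieldSlavingBlowupTypeIDssProfileSimilarityPressure
import Summits.NavierStokesRegularity.NavierStokesRegularity.Theorems.DssFarFieldSlavingBlowupTypeIDssProfileCorotatingProfileEq
import Summits.NavierStokesRegularity.NavierStokesRegularity.Theorems.DssFarFieldSlavingBlowupTypeIDssProfilePineauVicolClass
import Summits.NavierStokesRegularity.NavierStokesRegularity.Theorems.QuantisedSymmetryPolyhedralDssProfileExistsStubGaussianEnstrophyIdentityHelpers
import HarnessLib

/-!
# The co-rotating similarity profile of a Type-I rotated-DSS field satisfies the hypotheses of the E33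
  profile lemmas (pub-ns-dss E33-CL STEP 2, hypothesis package; route `DssFarFieldSlaving`, crux
  `BlowupTypeIDssProfile`, stmt-NavierStokesRegularity-0155 — SUPPORT; cell pub-ns-dss, typer seat g5,
  2026-08-23; imports the pressure dictionary `…SimilarityPressure.lean`, the co-rotating profile
  equation `…CorotatingProfileEq.lean`, the class files `…PineauVicolClass.lean` / `…ClassToProfile.lean`
  and the coordinate Poisson equation of the backward Leray system (`PolyhedralCell…Helpers`))

HONEST FRAMING. Bookkeeping: which tree facts discharge which binder of the profile-level E33 lemmas
(`GaussianHeadPressure.signCoherent_rdssProfile_trivial_slicePressure` and its period-mean variant) for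
the co-rotating similarity profile of a Type-I ancient mild field (KNSS gauge, space–time Type-I bound)
with a rotated `c`-DSS structure (Pineau–Vicol twist convention `IsRotatedDSS c (rotZLIE (−θ)) V`).
No sign hypothesis appears here and nothing is excluded; nothing here bears on Navier–Stokes regularity
or blow-up. Nothing is numeric.

THE OBJECTS. `α = θ / (2 log c)`, `U(y, s) = R_{−αs} (lerayOrbit V s)(R_{αs} y)` (`R_θ = rotZ θ`) and
`P(y, s) = e^{−s} Q[V(−e^{−s})](e^{−s/2} R_{αs} y)`, `Q = pressurePotential` the normalised
(Calderón–Zygmund) pressure of the slice (Tao 2011 (35); `= Q[lerayOrbit V s](R_{αs} y)` by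
`exp_mul_pressurePotential_eq`). `U`, `P` are taken as given functions with these values (pointwise
hypotheses), so that the package applies to opaque names.

THE PACKAGE (`typeI_rdss_corotatingProfile_hypotheses`), tree lemma by tree lemma: a classical pressure
`P₀` on the whole past (`RellichScarScarRigidity.exists_isClassicalNSSolutionOn_Iio`); `U` is the jointly
smooth `2 log c`-periodic profile of the dictionary (`contDiff_periodicProfile`,
`periodicProfile_add_period`, `screwInvariant_of_isRotatedDSS`); the co-rotating profile equation and
incompressibility (`corotatingProfile_momentum`, `corotatingProfile_isDivFree`) from the backward Leray
system of `(lerayOrbit V, lerayOrbitPressure P₀)`; `P(·, s)` differs from the co-rotated Leray pressure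
by a constant in `y` (`lerayOrbitPressure_eq_pressurePotential_add` + `exp_mul_pressurePotential_eq`),
hence the same gradient, smooth slices, and the trace Poisson equation
(`PolyhedralCell.gaussEnstrophy_sum_pderiv_pderiv_pressure` transported by
`sum_pderiv_pderiv_conj_linearIsometryEquiv`); the `s`-UNIFORM bounds `|U| ≤ M/(1+|y|)`, `‖DU‖ ≤ K₁`,
`‖ΔU‖ ≤ 3K₂` (scale-invariant gauge bounds `typeIGauge_exists_pow_mul_norm_iteratedFDeriv_le`),
`|P| ≤ M_P` (`exists_bound_abs_pressurePotential_lerayOrbit`), `‖∇P‖ ≤ B₀`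
(`exists_bound_norm_gradient_lerayOrbitPressure`), and `‖∂ₛU‖ ≤ L(1+|y|)` read off the profile
equation; one constant `C = M + K₁ + M_P + B₀ + L`, degree `N = 1`.
[this file; theory T42/E33 + E33-CLASS-BRIDGE v1.2 (S1)–(S3); typer]
-/

noncomputable section

set_option linter.dupNamespace false
-- nested operator types `ℝ³ →L[ℝ] ℝ³ →L[ℝ] ℝ³`
set_option maxSynthPendingDepth 3

namespace Summit.NavierStokesRegularity.NavierStokesRegularity.Theorems.GaussianHeadPressure

open Set Function Filter MeasureTheory InnerProductSpace Metric
open scoped RealInnerProductSpace Laplacian ContDiff Topology BigOperators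
open Literature.Analysis Literature.Analysis.FluidPDE Literature.Analysis.FluidPDE.PineauVicol2026
open Summit.NavierStokesRegularity.NavierStokesRegularity.Theorems
open Summit.NavierStokesRegularity.NavierStokesRegularity.Theorems.BlobRiccatiClosure.TypeIApexLiouville
  (typeIGauge_exists_pow_mul_norm_iteratedFDeriv_le)
open Summit.NavierStokesRegularity.NavierStokesRegularity.Theorems.GaussianGap
  (norm_iteratedFDeriv_lerayOrbit_le norm_lerayOrbit_le_of_typeI contDiff_lerayOrbit_slice_of_typeI)
open Summit.NavierStokesRegularity.NavierStokesRegularity.Theorems.PolyhedralDssProfileExists.PolyhedralCell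
  (gaussEnstrophy_sum_pderiv_pderiv_pressure)
open Summit.NavierStokesRegularity.NavierStokesRegularity.Theorems.SymmetricScarExists.RdssSplit.PineauVicol
  (contDiff_periodicProfile periodicProfile_add_period)

/-! ### Small calculus facts -/

/-- `R_θ (a • y) = a • R_θ y`. [folklore] -/
private theorem rotZ_smul_vec (θ a : ℝ) (y : EuclideanSpace ℝ (Fin 3)) :
    rotZ θ (a • y) = a • rotZ θ y := by
  rw [← rotZL_apply, map_smul, rotZL_apply]

/-- `‖J v‖ ≤ ‖v‖` for `J v = (−v₁, v₀, 0)`. [folklore] -/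
private theorem norm_rotGen_le_norm' (v : EuclideanSpace ℝ (Fin 3)) : ‖rotGen v‖ ≤ ‖v‖ := by
  have h1 : ‖rotGen v‖ ^ 2 ≤ ‖v‖ ^ 2 := by
    rw [EuclideanSpace.real_norm_sq_eq, EuclideanSpace.real_norm_sq_eq, Fin.sum_univ_three,
      Fin.sum_univ_three]
    simp only [rotGen_apply_zero, rotGen_apply_one, rotGen_apply_two]
    nlinarith [sq_nonneg (v 2)]
  exact (pow_le_pow_iff_left₀ (norm_nonneg _) (norm_nonneg _) two_ne_zero).1 h1

/-- From `a + x₁ + x₂ + x₃ − x₄ + x₅ + x₆ = 0`: `‖a‖ ≤ ‖x₁‖ + ‖x₂‖ + ‖x₃‖ + ‖x₄‖ + ‖x₅‖ + ‖x₆‖`. [folklore] -/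
private theorem norm_le_of_add_six_eq_zero {F : Type*} [SeminormedAddCommGroup F]
    {a x₁ x₂ x₃ x₄ x₅ x₆ : F} (h : a + x₁ + x₂ + x₃ - x₄ + x₅ + x₆ = 0) :
    ‖a‖ ≤ ‖x₁‖ + ‖x₂‖ + ‖x₃‖ + ‖x₄‖ + ‖x₅‖ + ‖x₆‖ := by
  have e : a = -(x₁ + x₂ + x₃ - x₄ + x₅ + x₆) := by
    rw [← sub_eq_zero, sub_neg_eq_add, ← h]
    abel
  rw [e, norm_neg]
  have h4 : ‖x₁ + x₂ + x₃ - x₄‖ ≤ ‖x₁ + x₂ + x₃‖ + ‖x₄‖ := norm_sub_le _ _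
  linarith [norm_add_le (x₁ + x₂ + x₃ - x₄ + x₅) x₆, norm_add_le (x₁ + x₂ + x₃ - x₄) x₅,
    norm_add_le (x₁ + x₂) x₃, norm_add_le x₁ x₂]

/-- `∂ₗ (f + c) = ∂ₗ f` for a constant `c`. [folklore] -/
private theorem pderiv_add_const' (l : Fin 3) (f : EuclideanSpace ℝ (Fin 3) → ℝ) (c : ℝ) :
    pderiv l (fun z => f z + c) = pderiv l f := by
  funext z
  rw [pderiv_apply, pderiv_apply, fderiv_add_const]

/-! ### The co-rotating profile of a Type-I rotated-DSS field satisfies every hypothesis of the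
profile lemmas -/

/-- **The hypothesis package.** For a Type-I ancient mild field `V` in the KNSS gauge with the
space–time Type-I bound and the rotated-DSS structure `IsRotatedDSS c (rotZLIE (−θ)) V` (`1 < c`), the
co-rotating similarity profile `U(y,s) = R_{−αs}(lerayOrbit V s)(R_{αs} y)` and the transported
Calderón–Zygmund pressure `P(y,s) = e^{−s} Q[V(−e^{−s})](e^{−s/2} R_{αs} y)` (`α = θ/(2 log c)`; `U`, `P`
given pointwise) satisfy EVERY structural and growth hypothesis of the tree's E33 profile lemmas
(`GaussianHeadPressure.signCoherent_rdssProfile_trivial_slicePressure` and its period-mean variant):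
joint smoothness, slice-wise smooth pressure, `2 log c`-periodicity, Pineau–Vicol's rotated profile
system (1.14a) slice by slice, incompressibility, the trace Poisson equation, and — with ONE constant
`C` and degree `N = 1` — `|U| ≤ C/(1+|y|)`, `‖D_yU‖ ≤ C`, `|P| ≤ C(1+|y|)`, `|∂ₛU| ≤ C(1+|y|)`,
`‖∇_yP‖ ≤ C(1+|y|)`; and `lerayOrbit V s y = R_{αs} U(R_{−αs} y, s)`. See the module docstring for
the tree lemmas composed. [this file; theory T42/E33 + E33-CLASS-BRIDGE v1.2 (S1)–(S3); typer] -/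
theorem typeI_rdss_corotatingProfile_hypotheses {M c θ : ℝ}
    {V : ℝ → EuclideanSpace ℝ (Fin 3) → EuclideanSpace ℝ (Fin 3)} (hc : 1 < c)
    (hT : IsTypeIAncientMild M V) (hR : IsRotatedDSS c (rotZLIE (-θ)) V) (hVdec : HasTypeIDecay M V)
    {U : EuclideanSpace ℝ (Fin 3) → ℝ → EuclideanSpace ℝ (Fin 3)} {P : EuclideanSpace ℝ (Fin 3) → ℝ → ℝ}
    (hUys : ∀ y s, U y s = rotZ (-(θ / (2 * Real.log c) * s))
      (lerayOrbit V s (rotZ (θ / (2 * Real.log c) * s) y)))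
    (hPys : ∀ y s, P y s = Real.exp (-s) * pressurePotential (V (-Real.exp (-s)))
      (Real.exp (-s / 2) • rotZ (θ / (2 * Real.log c) * s) y)) :
    ContDiff ℝ ∞ (fun q : EuclideanSpace ℝ (Fin 3) × ℝ => U q.1 q.2) ∧
    (∀ s, ContDiff ℝ ∞ fun z => P z s) ∧
    (∀ y s, U y (s + 2 * Real.log c) = U y s) ∧
    (∀ s y, fderiv ℝ (fun σ => U y σ) s 1 +
        (θ / (2 * Real.log c)) • (rotGen (U y s) - fderiv ℝ (fun z => U z s) y (rotGen y)) +
        (1 / 2 : ℝ) • U y s + (1 / 2 : ℝ) • fderiv ℝ (fun z => U z s) y y -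
        (Δ (fun z => U z s)) y + convect (fun z => U z s) (fun z => U z s) y +
        gradient (fun z => P z s) y = 0) ∧
    (∀ s, VectorCalculus.IsDivFree fun z => U z s) ∧
    (∀ s y, ∑ l, pderiv l (pderiv l fun z => P z s) y =
      -∑ l, ∑ j, pderiv l (fun z => U z s j) y * pderiv j (fun z => U z s l) y) ∧
    (∀ s y, lerayOrbit V s y =
      rotZ (θ / (2 * Real.log c) * s) (U (rotZ (-(θ / (2 * Real.log c) * s)) y) s)) ∧
    ∃ C : ℝ, (∀ s y, ‖U y s‖ ≤ C / (1 + ‖y‖)) ∧ (∀ s y, ‖fderiv ℝ (fun z => U z s) y‖ ≤ C) ∧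
      (∀ s y, |P y s| ≤ C * (1 + ‖y‖) ^ 1) ∧
      (∀ s y, ‖fderiv ℝ (fun σ => U y σ) s 1‖ ≤ C * (1 + ‖y‖) ^ 1) ∧
      (∀ s y, ‖gradient (fun z => P z s) y‖ ≤ C * (1 + ‖y‖) ^ 1) := by
  -- the angular speed
  set α : ℝ := θ / (2 * Real.log c) with hα
  -- a classical pressure on the whole past (Fabes–Jones–Rivière windows, glued)
  obtain ⟨P₀, hP⟩ := RellichScarScarRigidity.exists_isClassicalNSSolutionOn_Iio hT

  -- the similarity wave `lerayOrbit V` solves the backward Leray system with `lerayOrbitPressure P₀`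
  have hL : IsBackwardLeraySolutionOn univ 1 (lerayOrbit V) (lerayOrbitPressure P₀) :=
    isClassicalNSSolutionOn_Iio_iff_isBackwardLeraySolutionOn.1 hP
  have hW : ∀ s y, lerayOrbit V s y = rotZ (α * s) (U (rotZ (-(α * s)) y) s) := by
    intro s y
    rw [hUys, ← rotZ_add, ← rotZ_add, add_neg_cancel, rotZ_zero, rotZ_zero]
  -- `U` is the periodic profile of the dictionary: jointly smooth and `2 log c`-periodic
  have hUpt : ∀ y s, U y s = Real.exp (-s / 2) • rotZ (-(α * s))
      (V (-Real.exp (-s)) (Real.exp (-s / 2) • rotZ (α * s) y)) := fun y s => by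
    rw [hUys, lerayOrbit_apply, rotZ_smul_vec]
  have hUj : ContDiff ℝ ∞ (fun q : EuclideanSpace ℝ (Fin 3) × ℝ => U q.1 q.2) := by
    have e : (fun q : EuclideanSpace ℝ (Fin 3) × ℝ => U q.1 q.2) = fun q =>
        Real.exp (-q.2 / 2) • rotZ (-(α * q.2))
          (V (-Real.exp (-q.2)) (Real.exp (-q.2 / 2) • rotZ (α * q.2) q.1)) := by
      funext q; exact hUpt q.1 q.2
    rw [e]
    exact contDiff_periodicProfile hT.contDiffOn
  have hperU : ∀ y s, U y (s + 2 * Real.log c) = U y s := by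
    intro y s
    rw [hUpt, hUpt]
    exact periodicProfile_add_period hc (screwInvariant_of_isRotatedDSS hR) y s
  have hUsl : ∀ s, ContDiff ℝ ∞ (fun z => U z s) := fun s =>
    hUj.comp (contDiff_id.prodMk contDiff_const)
  -- the co-rotating profile equation (with the co-rotated Leray pressure) and incompressibility
  have heqQ := fun s y => corotatingProfile_momentum hL hUj hW s y
  have hdiv : ∀ s, VectorCalculus.IsDivFree fun z => U z s := fun s =>
    corotatingProfile_isDivFree hW (hL.divFree s (mem_univ s))
  -- the statement's pressure is the co-rotated Leray pressure up to a constant in `y`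
  set κ : ℝ → ℝ := fun s =>
    Real.exp (-s) * (P₀ (-Real.exp (-s)) 0 - pressurePotential (V (-Real.exp (-s))) 0) with hκ_def
  have hPW : ∀ s z, P z s = pressurePotential (lerayOrbit V s) (rotZ (α * s) z) := by
    intro s z
    have ht : -Real.exp (-s) < 0 := neg_neg_of_pos (Real.exp_pos _)
    have hV2 : ContDiff ℝ 2 (V (-Real.exp (-s))) :=
      (hP.contDiff_velocity (show -Real.exp (-s) ∈ Iio (0 : ℝ) from ht)).of_le (by norm_cast)
    rw [hPys]
    exact exp_mul_pressurePotential_eq hVdec s hV2 _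
  have hPfun : ∀ s, (fun z => P z s) = fun z => lerayOrbitPressure P₀ s (rotZ (α * s) z) + (-κ s) := by
    intro s
    funext z
    rw [hPW, lerayOrbitPressure_eq_pressurePotential_add hP hVdec s]
    simp only [hκ_def]
    ring
  -- consequences: smooth slices, same gradient, trace Poisson
  have hPsl : ∀ s, ContDiff ℝ ∞ fun z => P z s := by
    intro s
    rw [hPfun s]
    exact ((hL.contDiff_pressure (mem_univ s)).comp (rotZLIE (α * s)).contDiff).add contDiff_const
  have hgradP : ∀ s y, gradient (fun z => P z s) y =
      gradient (fun z => lerayOrbitPressure P₀ s (rotZ (α * s) z)) y := by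
    intro s y
    rw [hPfun s, gradient, gradient, fderiv_add_const]
  have heq : ∀ s y, fderiv ℝ (fun σ => U y σ) s 1 +
      α • (rotGen (U y s) - fderiv ℝ (fun z => U z s) y (rotGen y)) +
      (1 / 2 : ℝ) • U y s + (1 / 2 : ℝ) • fderiv ℝ (fun z => U z s) y y -
      (Δ (fun z => U z s)) y + convect (fun z => U z s) (fun z => U z s) y +
      gradient (fun z => P z s) y = 0 := by
    intro s y
    rw [hgradP]
    exact heqQ s y
  have hΔP : ∀ s y, ∑ l, pderiv l (pderiv l fun z => P z s) y =
      -∑ l, ∑ j, pderiv l (fun z => U z s j) y * pderiv j (fun z => U z s l) y := by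
    intro s y
    -- the rotated frame `R = R_{−αs}`, `R⁻¹ = R_{αs}`
    set R : EuclideanSpace ℝ (Fin 3) ≃ₗᵢ[ℝ] EuclideanSpace ℝ (Fin 3) := rotZLIE (-(α * s)) with hR_def
    have hRs : ∀ z, R.symm z = rotZ (α * s) z := fun z => by
      rw [hR_def, rotZLIE_symm_apply, neg_neg]
    have hUs : ∀ z, U z s = R (lerayOrbit V s (R.symm z)) := fun z => by
      rw [hRs, hUys]; rfl
    have hPs : ∀ z, P z s = lerayOrbitPressure P₀ s (R.symm z) + (-κ s) := fun z => by
      rw [hRs]; exact congrFun (hPfun s) z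
    have hWd : Differentiable ℝ (lerayOrbit V s) :=
      (hL.contDiff_velocity (mem_univ s)).differentiable (by simp)
    have hQ2 : ContDiff ℝ 2 (fun x => lerayOrbitPressure P₀ s x + (-κ s)) :=
      ((hL.contDiff_pressure (mem_univ s)).of_le (by norm_cast)).add contDiff_const
    have hQW : ∀ x, ∑ l, pderiv l (pderiv l fun x => lerayOrbitPressure P₀ s x + (-κ s)) x =
        -∑ l, ∑ j, pderiv l (fun z => lerayOrbit V s z j) x *
          pderiv j (fun z => lerayOrbit V s z l) x := by
      intro x
      have h0 := gaussEnstrophy_sum_pderiv_pderiv_pressure hL s x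
      simp only [pderiv_add_const'] 
      exact h0
    exact sum_pderiv_pderiv_conj_linearIsometryEquiv R hWd hQ2 hQW hUs hPs y
  -- class-uniform bounds, `s`-independent
  obtain ⟨K₁, hK₁⟩ := typeIGauge_exists_pow_mul_norm_iteratedFDeriv_le M 1
  obtain ⟨K₂, hK₂⟩ := typeIGauge_exists_pow_mul_norm_iteratedFDeriv_le M 2
  obtain ⟨MP, hMP0, hMP⟩ := exists_bound_abs_pressurePotential_lerayOrbit M
  obtain ⟨B, hB0, hB⟩ := exists_bound_norm_gradient_lerayOrbitPressure M
  have hM0 : 0 ≤ M := hT.nonneg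
  have bWdec : ∀ s x, ‖lerayOrbit V s x‖ ≤ M / (1 + ‖x‖) := fun s x => by
    rw [add_comm]; exact hVdec.norm_lerayOrbit_le s x
  have bW1 : ∀ s x, ‖fderiv ℝ (lerayOrbit V s) x‖ ≤ K₁ := fun s x => by
    rw [← norm_iteratedFDeriv_one]; exact norm_iteratedFDeriv_lerayOrbit_le hT hK₁ s x
  have bW2 : ∀ s x, ‖iteratedFDeriv ℝ 2 (lerayOrbit V s) x‖ ≤ K₂ := fun s x =>
    norm_iteratedFDeriv_lerayOrbit_le hT hK₂ s x
  have hK₁0 : 0 ≤ K₁ := (norm_nonneg _).trans (bW1 0 0)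
  have hK₂0 : 0 ≤ K₂ := (norm_nonneg _).trans (bW2 0 0)
  -- transported to the co-rotating frame
  have hUb : ∀ s y, ‖U y s‖ ≤ M / (1 + ‖y‖) := by
    intro s y
    rw [hUys, norm_rotZ]
    have h := bWdec s (rotZ (α * s) y)
    rwa [norm_rotZ] at h
  have hUb' : ∀ s y, ‖U y s‖ ≤ M := fun s y =>
    (hUb s y).trans (div_le_self hM0 (by linarith [norm_nonneg y]))
  have hDUb : ∀ s y, ‖fderiv ℝ (fun z => U z s) y‖ ≤ K₁ := by
    intro s y
    rw [corotatingProfile_slice_eq_conj hW s, fderiv_conj_linearIsometryEquiv]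
    refine ContinuousLinearMap.opNorm_le_bound _ hK₁0 fun v => ?_
    simp only [ContinuousLinearMap.coe_comp, Function.comp_apply, LinearIsometryEquiv.coe_coe'',
      LinearIsometryEquiv.norm_map]
    exact (ContinuousLinearMap.le_opNorm _ _).trans (by
      rw [LinearIsometryEquiv.norm_map]; exact mul_le_mul_of_nonneg_right (bW1 s _) (norm_nonneg _))
  have hΔUb : ∀ s y, ‖(Δ (fun z => U z s)) y‖ ≤ 3 * K₂ := by
    intro s y
    rw [corotatingProfile_slice_eq_conj hW s, laplacian_conj_linearIsometryEquiv,
      LinearIsometryEquiv.norm_map]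
    exact (PineauVicol2026.norm_laplacian_le_three_mul (lerayOrbit V s) _).trans
      (by linarith [bW2 s ((rotZLIE (-(α * s))).symm y)])
  have hPb : ∀ s y, |P y s| ≤ MP := fun s y => by
    rw [hPW]; exact hMP hT hVdec s _
  have hgQb : ∀ s y, ‖gradient (fun z => lerayOrbitPressure P₀ s (rotZ (α * s) z)) y‖ ≤ B := by
    intro s y
    have e : (fun z => lerayOrbitPressure P₀ s (rotZ (α * s) z)) =
        fun z => lerayOrbitPressure P₀ s ((rotZLIE (-(α * s))).symm z) := by
      funext z; rw [rotZLIE_symm_apply, neg_neg]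
    rw [e, gradient_comp_linearIsometryEquiv_symm, LinearIsometryEquiv.norm_map]
    exact hB hT P₀ hP s _
  have hgPb : ∀ s y, ‖gradient (fun z => P z s) y‖ ≤ B := fun s y => by
    rw [hgradP]; exact hgQb s y
  -- `∂ₛU` read off the profile equation: linear growth
  set L : ℝ := |α| * (M + K₁) + M / 2 + K₁ / 2 + 3 * K₂ + K₁ * M + B with hL_def
  have hL0 : 0 ≤ L := by positivity
  have hUsb : ∀ s y, ‖fderiv ℝ (fun σ => U y σ) s 1‖ ≤ L * (1 + ‖y‖) := by
    intro s y
    have h0 := norm_le_of_add_six_eq_zero (heq s y)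
    have h1 : ‖α • (rotGen (U y s) - fderiv ℝ (fun z => U z s) y (rotGen y))‖ ≤
        |α| * (M + K₁ * ‖y‖) := by
      rw [norm_smul, Real.norm_eq_abs]
      refine mul_le_mul_of_nonneg_left ((norm_sub_le _ _).trans (add_le_add ?_ ?_)) (abs_nonneg _)
      · exact (norm_rotGen_le_norm' _).trans (hUb' s y)
      · exact (ContinuousLinearMap.le_opNorm _ _).trans
          (mul_le_mul (hDUb s y) (norm_rotGen_le_norm' y) (norm_nonneg _) hK₁0)
    have h2 : ‖(1 / 2 : ℝ) • U y s‖ ≤ M / 2 := by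
      rw [norm_smul, Real.norm_of_nonneg (by norm_num : (0 : ℝ) ≤ 1 / 2)]
      linarith [hUb' s y]
    have h3 : ‖(1 / 2 : ℝ) • fderiv ℝ (fun z => U z s) y y‖ ≤ K₁ / 2 * ‖y‖ := by
      rw [norm_smul, Real.norm_of_nonneg (by norm_num : (0 : ℝ) ≤ 1 / 2)]
      have := (ContinuousLinearMap.le_opNorm (fderiv ℝ (fun z => U z s) y) y).trans
        (mul_le_mul_of_nonneg_right (hDUb s y) (norm_nonneg _))
      linarith
    have h4 : ‖(Δ (fun z => U z s)) y‖ ≤ 3 * K₂ := hΔUb s y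
    have h5 : ‖convect (fun z => U z s) (fun z => U z s) y‖ ≤ K₁ * M := by
      simp only [convect]
      exact (ContinuousLinearMap.le_opNorm _ _).trans
        (mul_le_mul (hDUb s y) (hUb' s y) (norm_nonneg _) hK₁0)
    have h6 : ‖gradient (fun z => P z s) y‖ ≤ B := hgPb s y
    have hy := norm_nonneg y
    have h7 : ‖fderiv ℝ (fun σ => U y σ) s 1‖ ≤
        |α| * (M + K₁ * ‖y‖) + M / 2 + K₁ / 2 * ‖y‖ + 3 * K₂ + K₁ * M + B := by
      linarith [h0, h1, h2, h3, h4, h5, h6]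
    refine h7.trans ?_
    rw [hL_def]
    nlinarith [abs_nonneg α, mul_nonneg (abs_nonneg α) hM0, mul_nonneg (abs_nonneg α) hK₁0,
      mul_nonneg hK₁0 hM0]
  -- one constant for the profile lemma (`N = 1`)
  set C : ℝ := M + K₁ + MP + B + L with hC_def
  have h1y : ∀ y : EuclideanSpace ℝ (Fin 3), (1 : ℝ) ≤ 1 + ‖y‖ := fun y => by
    linarith [norm_nonneg y]
  have hUbC : ∀ s y, ‖U y s‖ ≤ C / (1 + ‖y‖) := fun s y =>
    (hUb s y).trans (div_le_div_of_nonneg_right (by rw [hC_def]; linarith) (by linarith [h1y y]))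
  have hDUbC : ∀ s y, ‖fderiv ℝ (fun z => U z s) y‖ ≤ C := fun s y =>
    (hDUb s y).trans (by rw [hC_def]; linarith)
  have hPbC : ∀ s y, |P y s| ≤ C * (1 + ‖y‖) ^ 1 := fun s y => by
    rw [pow_one]
    exact (hPb s y).trans (by rw [hC_def]; nlinarith [h1y y])
  have hUsbC : ∀ s y, ‖fderiv ℝ (fun σ => U y σ) s 1‖ ≤ C * (1 + ‖y‖) ^ 1 := fun s y => by
    rw [pow_one]
    exact (hUsb s y).trans (mul_le_mul_of_nonneg_right (by rw [hC_def]; linarith) (by linarith [h1y y]))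
  have hgPbC : ∀ s y, ‖gradient (fun z => P z s) y‖ ≤ C * (1 + ‖y‖) ^ 1 := fun s y => by
    rw [pow_one]
    exact (hgPb s y).trans (by rw [hC_def]; nlinarith [h1y y])
  exact ⟨hUj, hPsl, hperU, heq, hdiv, hΔP, hW, C, hUbC, hDUbC, hPbC, hUsbC, hgPbC⟩

end Summit.NavierStokesRegularity.NavierStokesRegularity.Theorems.GaussianHeadPressure

end
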